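import Summits.QuantumFields.BalabanUV.Beta.D1BFx.TorusScalarCoarseGram
import Literature.MathematicalPhysics.QuantumFieldTheory.Balaban1983to89.Beta.BalabanStepJetsSucc

/-!
# `BalabanUV.Beta.D1BFx.TorusScalarCoarseArrays` — road «BF-x», binder row D1, slot (K), X₃(ii) ROUTE T, brick **K-TB3c PART 2, FILE 4** «THE S-JETS ARE
# PERIODISED COARSE ARRAYS»: between the block-averaging operators `QindU … QindUᵀ` of FILES 1–2, a bi-localised fine vertex dressed by two jointly
# periodic decaying legs is the periodisation of a COARSE PERIODIC ARRAY of a BI-LOCALISED COARSE VERTEX —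
# **`QindU · Â·(arr s V)^·B̂ · QindUᵀ = (arr p (blockSumK m ((A∘V)∘B)))^`**, `blockSumK m ((A∘V)∘B)` bi-localised at the block labels — and the road's
# instance `A = B = Ĝ′Ĝ′` (`(ÂX·ÂX)⁻¹`, FILE 2): the S-jets `Sₛ = −Qind·Ĝ′Ĝ′·Xₛ′·Ĝ′Ĝ′·Qindᵀ` of FILE 3's END are, for array jets `Xₛ′ = (arr s Vₛ)^`, in the
# shape TA3b's coarse sockets (`TorusGhostGram.tendsto_hessT_CsqK`) consume.

HONEST DEPENDENCY (cell records, verbatim): «continuum YM on T⁴ ⇐ BetaPertH ∧ nine spine estimates (0/9 proved); BetaPertH ⇐ (D1) ∧ (D4) ∧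
CAP+tail; G-an2-4 gates asym, D1 and NE2/3/4.»  HONEST FRAMING (cell contract, verbatim): «discharging `BetaPertH` makes Bałaban's UV stability
UNCONDITIONAL — a real constructive-QFT result; it is NOT the continuum limit and NOT the Clay problem.»  THIS MODULE DISCHARGES NOTHING of (K),
of D1 or of the wall: [folklore] absolutely convergent two-scale lattice bookkeeping over an2's `ExpKernelCalculus` (`comp`, `Decays`, `BiLoc`,
`biLoc_comp_decays`, `comp_shiftK`), `BalabanStepJetsSucc` (`decays_comp`, `biLoc_comp_right`), `KernelWard.bdd_of_decays`, TA2 `PeriodicArrays` (`arr`,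
`comp_arr_left`, `summable_arr_term`, `rowBound_arr`, `arr_imageShift`), TA3b `TorusTraceTadpole` (`toF_comp`, `periodiseF_toF_mul_arr`,
`summable_mul_of_decays_bdd`), leaf-03's `FibredPeriodisation.periodiseF_compF_matrix`, the typer's `GhostLeg` (`Ggh`, `decays_Ggh`, `bdd_Ggh`, `shiftK_Ggh`),
PART 1 `TorusGhostLegs` (`isPeriodic₂_Ggh`, `rowBound_Ggh`), FILE 1 (`Qind_mul_periodise₂_mul_Qind_transpose`, `blockSum`) and FILE 2 (`eU`, `QindU`) — all
USED BY NAME.  Two data definitions [our object] (`blockSumK`, `GG`); no `def … : Prop`, nothing cited, 0 sorry.  NOT D1, NOT BetaPertH, NOT continuum,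
NOT Clay.

ABSOLUTE RULE (cell charter, verbatim): «No internally-minted statement may enter as a cited fact. Every hypothesis is either kernel-proved in this
package or a verbatim quotation of a PUBLISHED theorem with page reference. The manuscript(s) under audit are NOT citable for their own disputed
steps — they are the thing under adjudication; programme-internal (2001/route/tribunal) claims are never citable.»

WHERE THIS SITS (`HOME/b2b-balaban-beta-d1-p2/K-ASSEMBLY-SPEC-v2.md` v2.3 §2 row K-TB3c, its «NOT HERE» item «the S-jets as periodised coarse arrays …»,
§4 TB5 «then `SortedTraces`∕TA3b limits on each of the four terms»).  FILE 3 (`TorusGhostSideZero.hessT_ghost_side_zero`) writes the ghost side at `U = 1`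
as `2·hessT Ĝ′ Lₛ Lₜ Lₛₜ + hessT ((m+1)⁻⁴•Ĉsq) Sₛ Sₜ Sₛₜ` with `Sₛ = −Qind·(Ĝ′Ĝ′)·Xₛ′·(Ĝ′Ĝ′)·Qindᵀ` etc.; the `p → ∞` socket for the second term
(`TorusGhostGram.tendsto_hessT_CsqK`, TA3b at `F = Unit` on the coarse torus) wants its jets as `(arr p W)^` for bi-localised COARSE vertices `W`.  THIS
FILE supplies exactly that conversion for array fine jets `Xₛ′ = (arr s Vₛ)^` (TB4-W's shape).
CONTENT (d = 4, scalar road kernels `MKer 4 Unit`, fine torus `Beta.Site 4 s`, coarse torus `Beta.Site 4 p`, `hs : s = (m+1)·p`; all [folklore]∕[our object]):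
* §1 [our object] `blockSumK m V` (block sums of a scalar road kernel, as a coarse road kernel); `periodiseF_toF_eq_submatrix` (the `× Unit` torus matrix IS
  the unfibred one through `eU`, `rfl`), **`QindU_mul_periodiseF_mul_QindU_transpose`** (FILE 1's two-scale unfold in the `× Unit` currency).
* §2 **`blockSumK_arr : blockSumK m (arr s V) = arr p (blockSumK m V)`**; `side_mul_abs_blk_sub_le` (`(m+1)|blk x i − blk P i| ≤ |x i − P i| + m`),
  `l1_blk_sub_blk_le` (`|blk x − blk P|₁ ≤ |x − P|₁ + 4m`), **`biLoc_blockSumK`** (block sums of a bi-localised vertex are bi-localised at the block labels,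
  same `ℓ¹` rate, constant `(m+1)⁸·C·e^{8δm}`).
* §3 `isPeriodic₂_of_imageShift`, `rowBound_of_decays`, **`periodiseF_toF_arr_mul`** (`(arr W)^·B̂ = (arr (W∘B))^`, the right twin of TA3b's
  `periodiseF_toF_mul_arr`), **`sandwich_arr`** (`Â·(arr V)^·B̂ = (arr ((A∘V)∘B))^`), `biLoc_sandwich`, **`QindU_sandwich_arr`** (the display above).
* §4 [our object] `GG m a := Ggh (m+1) a ∘ Ggh (m+1) a`; `decays_GG`, `rate_GG_pos`, `GG_imageShift`, **`periodiseF_Ggh_mul_Ggh : Ĝ′·Ĝ′ = (GG)^`**,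
  **`QindU_ghost_sandwich_arr`** (`QindU·Ĝ′Ĝ′·(arr s V)^·Ĝ′Ĝ′·QindUᵀ = (arr p (blockSumK m ((GG∘V)∘GG)))^` + the coarse vertex is bi-localised).
* §5 [folklore] NORMALISATION: `hessT_inv_smul` (`hessT (c•X₀)⁻¹ (c•Xₛ) (c•Xₜ) (c•Xₛₜ) = hessT X₀⁻¹ Xₛ Xₜ Xₛₜ`), **`hessT_sandwich_smul`** (the compressed
  functional of FILE 3's END is blind to the Laplacian's normalisation: `c = (m+1)⁴` turns the jets of `L̂²` ∕ `N̂ᵀL_UL_UN̂` into those of `((m+1)²•L̂)²`).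
NOT HERE: the unfibred (`Qind`, `Ghat`) reading of §4 (one `submatrix_mul_equiv` chain with FILE 2's bridges), the three-vertex word of `Sₛₜ` (two arrays:
TA2's `comp_arr_arr` pattern, same method), the identification of the coarse vertices with the END's unit-class Gram rows (dictionary of record — the
owner's), the `p → ∞` limit itself.
Provenance: NE9 formalisation swarm leaf seat `b2b-balaban-t4-ne9-formalise-leaf-02` gen 26 (cross-row prover duty NE9 → β∕D1 road «BF-x»; journal CLAIM
«K-TB3c PART 2» l.22923), 2026-08-21.
-/

noncomputable section

namespace Summit.QuantumFields.BalabanUV.Beta.D1BFx.TorusScalarCoarseArrays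

open Finset Matrix
open scoped BigOperators
open Literature.MathematicalPhysics.QuantumFieldTheory.Balaban1983to89
open Literature.MathematicalPhysics.QuantumFieldTheory.Balaban1983to89.Beta
open Literature.MathematicalPhysics.QuantumFieldTheory.Balaban1983to89.B12Sec2to5 (l1 l1_nonneg)
open B6QGQLower276 (X side blk B mem_B sum_B_const chart blk_chart side_facts)
open B6QGQDecay237 (deltaU deltaU_pos)
open ExpKernelCalculus (MKer Decays BiLoc comp)
open KernelWard (Bdd bdd_of_decays)
open ExpKernelCalculus (shiftK comp_shiftK biLoc_comp_decays)
open BalabanStepJetsSucc (decays_comp biLoc_comp_right)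
open Summit.QuantumFields.BalabanUV.Beta.TameKernelCalculus (decays_of_le biLoc_of_le)
open Summit.QuantumFields.BalabanUV.Beta.D1BFx.FibredPeriodisation (periodiseF Kfib Kfib_apply periodiseF_apply periodiseF_compF_matrix)
open Summit.QuantumFields.BalabanUV.Beta.D1BFx.PeriodicArrays
open Summit.QuantumFields.BalabanUV.Beta.D1BFx.TorusTraceTadpole (toF_comp summable_abs_row_toF periodiseF_toF_mul_arr summable_mul_of_decays_bdd bdd_of_biLoc)
open Summit.QuantumFields.BalabanUV.Beta.D1BFx.GhostLeg (Ggh decays_Ggh bdd_Ggh blk_translate shiftK_Ggh)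
open Summit.QuantumFields.BalabanUV.Beta.D1BFx.TorusGhostLegs (Ggh_imageShift isPeriodic₂_Ggh rowBound_Ggh)
open Summit.QuantumFields.BalabanUV.Beta.D1BFx.PeriodisedKernels (imageShift_eq_add_side_smul)
open Summit.QuantumFields.BalabanUV.Beta.D1BFx.PeriodisedProjector (sum_B_add)
open Summit.QuantumFields.BalabanUV.Beta.D1BFx.TorusScalarAveraging (Qind blockSum Qind_mul_periodise₂_mul_Qind_transpose imageShift_eq_add_zsmul)
open Summit.QuantumFields.BalabanUV.Beta.D1BFx.TorusScalarCoarseGram (eU QindU)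

/-! ## §1 Block sums of scalar road kernels; the two-scale unfold in the `× Unit` currency -/

/-- [our object] **BLOCK SUMS OF A SCALAR ROAD KERNEL** read back as a (coarse) scalar road kernel: `blockSumK m V y y′ () () := blockSum m V(· · () ()) y y′`. -/
def blockSumK (m : ℕ) (V : MKer 4 Unit) : MKer 4 Unit := fun y y' _ _ => blockSum m (Kfib (toF V) () ()) y y'

section Unfold

variable {m s p : ℕ} [NeZero s] [NeZero p]

omit [NeZero s] [NeZero p] in
/-- [our object] Unfolding `blockSumK`. -/
@[simp] theorem blockSumK_apply (V : MKer 4 Unit) (y y' : X 4) (u v : Unit) :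
    blockSumK m V y y' u v = ∑ x ∈ B m y, ∑ x' ∈ B m y', V x x' () () := by
  obtain ⟨⟩ := u; obtain ⟨⟩ := v; rfl

omit [NeZero p] in
/-- [folklore] The `× Unit` torus matrix of a scalar road kernel is the unfibred one read through `eU`: definitional. -/
theorem periodiseF_toF_eq_submatrix (V : MKer 4 Unit) :
    Matrix.of (periodiseF s (toF V)) = (Matrix.of (periodise₂ s (Kfib (toF V) () ()))).submatrix (eU s) (eU s) := by
  ext ⟨x, u⟩ ⟨y, v⟩
  rfl

/-- [folklore] **THE TWO-SCALE UNFOLD IN THE `× Unit` CURRENCY**: for a scalar road kernel `V` with jointly `s`-periodic, summable rows (`s = (m+1)·p`),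
`QindU · V^ · QindUᵀ = (blockSumK m V)^` — FILE 1's `Qind_mul_periodise₂_mul_Qind_transpose` read through `eU`. -/
theorem QindU_mul_periodiseF_mul_QindU_transpose (hs : s = (m + 1) * p) (V : MKer 4 Unit)
    (hper : ∀ x y t : X 4, V (imageShift s x t) (imageShift s y t) () () = V x y () ()) (hrow : ∀ x : X 4, Summable fun y => V x y () ()) :
    QindU (m + 1) s p * Matrix.of (periodiseF s (toF V)) * (QindU (m + 1) s p)ᵀ = Matrix.of (periodiseF p (toF (blockSumK m V))) := by
  have h := Qind_mul_periodise₂_mul_Qind_transpose m hs (K := Kfib (toF V) () ()) (fun x y t => hper x y t) hrow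
  rw [periodiseF_toF_eq_submatrix, periodiseF_toF_eq_submatrix, QindU, Matrix.transpose_submatrix, Matrix.submatrix_mul_equiv,
    Matrix.submatrix_mul_equiv, show m + 1 - 1 = m from rfl, h]
  rfl

end Unfold

/-! ## §2 Block sums of periodic arrays are periodic arrays of block sums; block sums of bi-localised vertices are bi-localised -/

section Arrays

variable {m s p : ℕ} {V : MKer 4 Unit} {P Q : X 4} {C δ : ℝ}

/-- [folklore] **`blockSumK m (arr s V) = arr p (blockSumK m V)`** (`s = (m+1)·p`, `V` bi-localised): the image series pulled through the two finite block
sums, and `B m (y + p•t) = B m y + s•t`. -/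
theorem blockSumK_arr [NeZero s] (hs : s = (m + 1) * p) (hV : BiLoc V P Q C δ) (hδ : 0 < δ) : blockSumK m (arr s V) = arr p (blockSumK m V) := by
  funext y y' u v
  obtain ⟨⟩ := u; obtain ⟨⟩ := v
  simp only [blockSumK_apply, arr_apply]
  have hsm : ∀ x x' : X 4, Summable fun t : X 4 => V (imageShift s x t) (imageShift s x' t) () () :=
    fun x x' => summable_arr_term hV hδ s x x' () ()
  rw [Finset.sum_congr rfl fun x _ => (Summable.tsum_finsetSum fun x' _ => hsm x x').symm,
    ← Summable.tsum_finsetSum fun x _ => summable_sum fun x' _ => hsm x x']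
  refine tsum_congr fun t => ?_
  rw [imageShift_eq_add_zsmul, imageShift_eq_add_zsmul, sum_B_add]
  refine Finset.sum_congr rfl fun x _ => ?_
  rw [sum_B_add]
  refine Finset.sum_congr rfl fun x' _ => ?_
  rw [imageShift_eq_add_side_smul m hs, imageShift_eq_add_side_smul m hs]

/-- [folklore] **BLOCK LABELS ARE `(m+1)`-LIPSCHITZ UP TO THE BLOCK SIDE**: `(m+1)·|blk x i − blk P i| ≤ |x i − P i| + m` (write `x i = (m+1)b + r`,
`0 ≤ r ≤ m`). -/
theorem side_mul_abs_blk_sub_le (m : ℕ) (x P : X 4) (i : Fin 4) : ((m : ℤ) + 1) * |blk m x i - blk m P i| ≤ |x i - P i| + m := by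
  have hs : (0 : ℤ) < (m : ℤ) + 1 := by positivity
  have hx := Int.emod_add_mul_ediv (x i) ((m : ℤ) + 1)
  have hP := Int.emod_add_mul_ediv (P i) ((m : ℤ) + 1)
  have hr0 := Int.emod_nonneg (x i) hs.ne'
  have hr1 := Int.emod_lt_of_pos (x i) hs
  have hq0 := Int.emod_nonneg (P i) hs.ne'
  have hq1 := Int.emod_lt_of_pos (P i) hs
  rw [show blk m x i = x i / ((m : ℤ) + 1) from rfl, show blk m P i = P i / ((m : ℤ) + 1) from rfl,
    show ((m : ℤ) + 1) * |x i / ((m : ℤ) + 1) - P i / ((m : ℤ) + 1)| = |((m : ℤ) + 1) * (x i / ((m : ℤ) + 1)) - ((m : ℤ) + 1) * (P i / ((m : ℤ) + 1))|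
      by rw [← mul_sub, abs_mul, abs_of_pos hs],
    show ((m : ℤ) + 1) * (x i / ((m : ℤ) + 1)) - ((m : ℤ) + 1) * (P i / ((m : ℤ) + 1))
      = (x i - P i) + (P i % ((m : ℤ) + 1) - x i % ((m : ℤ) + 1)) by linarith]
  refine (abs_add_le _ _).trans ?_
  have h : |P i % ((m : ℤ) + 1) - x i % ((m : ℤ) + 1)| ≤ m := abs_le.2 ⟨by linarith, by linarith⟩
  linarith

/-- [folklore] **`ℓ¹` FORM**: `|blk x − blk P|₁ ≤ |x − P|₁ + 4m` (the previous bound, `m + 1 ≥ 1`, summed over the four coordinates). -/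
theorem l1_blk_sub_blk_le (m : ℕ) (x P : X 4) : l1 (blk m x - blk m P) ≤ l1 (x - P) + 4 * m := by
  have hc : ∀ i : Fin 4, (|((blk m x - blk m P) i : ℤ)| : ℝ) ≤ |((x - P) i : ℤ)| + m := by
    intro i
    have h1 := side_mul_abs_blk_sub_le m x P i
    have h2 : |blk m x i - blk m P i| ≤ ((m : ℤ) + 1) * |blk m x i - blk m P i| :=
      le_mul_of_one_le_left (abs_nonneg _) (by linarith [Int.natCast_nonneg m])
    have h3 : |blk m x i - blk m P i| ≤ |x i - P i| + m := h2.trans h1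
    have h4 : ((|blk m x i - blk m P i| : ℤ) : ℝ) ≤ ((|x i - P i| + m : ℤ) : ℝ) := by exact_mod_cast h3
    simpa [Pi.sub_apply, Int.cast_abs] using h4
  have hc' : ∀ i : Fin 4, |(((blk m x - blk m P) i : ℤ) : ℝ)| ≤ |(((x - P) i : ℤ) : ℝ)| + m := fun i => by
    have := hc i; simp only [Int.cast_abs] at this ⊢; exact this
  simp only [l1]
  calc ∑ μ, |(((blk m x - blk m P) μ : ℤ) : ℝ)| ≤ ∑ μ : Fin 4, (|(((x - P) μ : ℤ) : ℝ)| + m) := Finset.sum_le_sum fun i _ => hc' i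
    _ = ∑ μ, |(((x - P) μ : ℤ) : ℝ)| + 4 * m := by
        rw [Finset.sum_add_distrib, Finset.sum_const, Finset.card_univ, Fintype.card_fin, nsmul_eq_mul]; push_cast; ring

/-- [folklore] **BLOCK SUMS OF A BI-LOCALISED VERTEX ARE BI-LOCALISED** at the block labels, same `ℓ¹` rate, constant `(m+1)⁸·C·e^{8δm}`
(`(m+1)⁴` points per block twice; `|x − P|₁ ≥ |blk x − blk P|₁ − 4m`). -/
theorem biLoc_blockSumK (m : ℕ) (hV : BiLoc V P Q C δ) (hδ : 0 ≤ δ) :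
    BiLoc (blockSumK m V) (blk m P) (blk m Q) (((m : ℝ) + 1) ^ 4 * ((m : ℝ) + 1) ^ 4 * C * Real.exp (δ * (8 * m))) δ := by
  intro y y' u v
  have hC : 0 ≤ C := hV.nonneg ()
  rw [blockSumK_apply]
  have hterm : ∀ x ∈ B m y, ∀ x' ∈ B m y', |V x x' () ()| ≤ C * Real.exp (δ * (8 * m)) * Real.exp (-δ * (l1 (y - blk m P) + l1 (y' - blk m Q))) := by
    intro x hx x' hx'
    have hbx : blk m x = y := mem_B.1 hx
    have hbx' : blk m x' = y' := mem_B.1 hx'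
    refine (hV x x' () ()).trans ?_
    rw [mul_assoc, ← Real.exp_add]
    refine mul_le_mul_of_nonneg_left (Real.exp_le_exp.2 ?_) hC
    have h1 := l1_blk_sub_blk_le m x P
    have h2 := l1_blk_sub_blk_le m x' Q
    rw [hbx] at h1; rw [hbx'] at h2
    nlinarith [l1_nonneg (x - P), l1_nonneg (x' - Q)]
  calc |∑ x ∈ B m y, ∑ x' ∈ B m y', V x x' () ()|
      ≤ ∑ x ∈ B m y, |∑ x' ∈ B m y', V x x' () ()| := Finset.abs_sum_le_sum_abs _ _
    _ ≤ ∑ x ∈ B m y, ∑ x' ∈ B m y', |V x x' () ()| := Finset.sum_le_sum fun x _ => Finset.abs_sum_le_sum_abs _ _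
    _ ≤ ∑ x ∈ B m y, ∑ x' ∈ B m y', C * Real.exp (δ * (8 * m)) * Real.exp (-δ * (l1 (y - blk m P) + l1 (y' - blk m Q))) :=
        Finset.sum_le_sum fun x hx => Finset.sum_le_sum fun x' hx' => hterm x hx x' hx'
    _ = ((m : ℝ) + 1) ^ 4 * ((m : ℝ) + 1) ^ 4 * C * Real.exp (δ * (8 * m)) * Real.exp (-δ * (l1 (y - blk m P) + l1 (y' - blk m Q))) := by
        rw [sum_B_const, sum_B_const]; ring

end Arrays

/-! ## §3 A bi-localised vertex dressed by two periodic decaying legs is a periodic array; between `QindU`'s it is a COARSE array -/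

section Dressed

variable {m s p : ℕ} [NeZero s] [NeZero p] {A Bk V : MKer 4 Unit} {P Q : X 4} {CA δA CB δB C δ : ℝ}

omit [NeZero s] [NeZero p] in
/-- [folklore] Periodicity of a scalar road kernel, read as joint `s`-periodicity of its (only) fibre. -/
theorem isPeriodic₂_of_imageShift (hper : ∀ x y t : X 4, ∀ u v : Unit, Bk (imageShift s x t) (imageShift s y t) u v = Bk x y u v) (u v : Unit) :
    IsPeriodic₂ s (Kfib (toF Bk) u v) := fun x y t => hper x y t u v

omit [NeZero p] in
/-- [folklore] A UNIFORM `ℓ¹` ROW BOUND for the fibres of a decaying scalar road kernel (`Decay₂.rowBound`). -/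
theorem rowBound_of_decays (hB : Decays Bk CB δB) (hδB : 0 < δB) (u v : Unit) :
    RowBound (Kfib (toF Bk) u v) (CB * ∑' w : X 4, Real.exp (-δB * l1 w)) := by
  have h2 : Decay₂ (Kfib (toF Bk) u v) CB δB := fun x y => by rw [Kfib_toF]; exact hB x y u v
  exact h2.rowBound hδB

/-- [folklore] **RIGHT TADPOLE PRODUCT ON THE TORUS**: `(arr s W)^ · B̂ = (arr s (W ∘ B))^` for a jointly `s`-periodic decaying leg `B` and a bi-localised
vertex `W` (TA2's `comp_arr_left` + the fibred product rule; the twin of TA3b's `periodiseF_toF_mul_arr`). -/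
theorem periodiseF_toF_arr_mul (hB : Decays Bk CB δB) (hδB : 0 < δB)
    (hBper : ∀ x y t : X 4, ∀ u v : Unit, Bk (imageShift s x t) (imageShift s y t) u v = Bk x y u v) (hW : BiLoc V P Q C δ) (hδ : 0 < δ) :
    Matrix.of (periodiseF s (toF (arr s V))) * Matrix.of (periodiseF s (toF Bk)) = Matrix.of (periodiseF s (toF (arr s (comp V Bk)))) := by
  have hsum : ∀ x z : X 4, ∀ a b f : Unit, Summable fun y : X 4 => arr s V x y a f * Bk y z f b := by
    intro x z a b f
    refine Summable.of_norm_bounded ((summable_abs_row_arr hW hδ s a f x).mul_right CB) fun y => ?_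
    rw [Real.norm_eq_abs, abs_mul, Kfib_toF]
    exact mul_le_mul_of_nonneg_left (bdd_of_decays hB hδB.le y z f b) (abs_nonneg _)
  rw [← comp_arr_left hB hδB hBper hW hδ, ← toF_comp hsum,
    periodiseF_compF_matrix (summable_abs_row_arr hW hδ s) (isPeriodic₂_of_imageShift hBper) (rowBound_of_decays hB hδB)]

/-- [folklore] **THE DRESSED VERTEX IS AN ARRAY**: `Â · (arr s V)^ · B̂ = (arr s ((A ∘ V) ∘ B))^` for jointly `s`-periodic decaying legs `A`, `B` and a
bi-localised vertex `V`. -/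
theorem sandwich_arr (hA : Decays A CA δA) (hδA : 0 < δA) (hAper : ∀ x y t : X 4, ∀ u v : Unit, A (imageShift s x t) (imageShift s y t) u v = A x y u v)
    (hB : Decays Bk CB δB) (hδB : 0 < δB) (hBper : ∀ x y t : X 4, ∀ u v : Unit, Bk (imageShift s x t) (imageShift s y t) u v = Bk x y u v)
    (hV : BiLoc V P Q C δ) (hδ : 0 < δ) :
    Matrix.of (periodiseF s (toF A)) * Matrix.of (periodiseF s (toF (arr s V))) * Matrix.of (periodiseF s (toF Bk))
      = Matrix.of (periodiseF s (toF (arr s (comp (comp A V) Bk)))) := by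
  -- `A ∘ V` is bi-localised at the common rate `min δA δ / 2`
  have hδ₀ : 0 < min δA δ := lt_min hδA hδ
  have hAV := biLoc_comp_decays (decays_of_le hA (min_le_left δA δ)) (biLoc_of_le hV (min_le_right δA δ)) (half_pos hδ₀).le (half_lt_self hδ₀)
  rw [periodiseF_toF_mul_arr hA hδA hAper hV hδ, periodiseF_toF_arr_mul hB hδB hBper hAV (half_pos hδ₀)]

/-- [folklore] **THE DRESSED VERTEX IS BI-LOCALISED** (at the same points, rate `min δA δB δ ∕ 4`). -/
theorem biLoc_sandwich (hA : Decays A CA δA) (hδA : 0 < δA) (hB : Decays Bk CB δB) (hδB : 0 < δB) (hV : BiLoc V P Q C δ) (hδ : 0 < δ) :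
    ∃ C' : ℝ, BiLoc (comp (comp A V) Bk) P Q C' (min (min δA δB) δ / 4) := by
  set δ₀ : ℝ := min (min δA δB) δ with hδ₀
  have hδ₀pos : 0 < δ₀ := lt_min (lt_min hδA hδB) hδ
  have hA₀ : Decays A (|CA|) δ₀ := decays_of_le hA ((min_le_left _ _).trans (min_le_left _ _))
  have hB₀ : Decays Bk (|CB|) (δ₀ / 2) := decays_of_le hB (by linarith [(min_le_left (min δA δB) δ).trans (min_le_right δA δB), half_le_self hδ₀pos.le])
  have hV₀ : BiLoc V P Q (|C|) δ₀ := biLoc_of_le hV (min_le_right _ _)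
  have hAV := biLoc_comp_decays hA₀ hV₀ (half_pos hδ₀pos).le (half_lt_self hδ₀pos)
  exact ⟨_, by
    have h := biLoc_comp_right hAV hB₀ (by positivity : (0 : ℝ) ≤ δ₀ / 4) (by linarith)
    rwa [show δ₀ / 4 = min (min δA δB) δ / 4 from rfl] at h⟩

/-- [folklore] **BETWEEN THE BLOCK-AVERAGING OPERATORS THE DRESSED VERTEX IS A PERIODISED COARSE ARRAY** (`s = (m+1)·p`):
`QindU · Â·(arr s V)^·B̂ · QindUᵀ = (arr p (blockSumK m ((A∘V)∘B)))^` — the TA3b-ready shape of the S-jets of `TorusGhostSideZero` (`A = B = Ĝ′Ĝ′`). -/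
theorem QindU_sandwich_arr (hs : s = (m + 1) * p) (hA : Decays A CA δA) (hδA : 0 < δA)
    (hAper : ∀ x y t : X 4, ∀ u v : Unit, A (imageShift s x t) (imageShift s y t) u v = A x y u v)
    (hB : Decays Bk CB δB) (hδB : 0 < δB) (hBper : ∀ x y t : X 4, ∀ u v : Unit, Bk (imageShift s x t) (imageShift s y t) u v = Bk x y u v)
    (hV : BiLoc V P Q C δ) (hδ : 0 < δ) :
    QindU (m + 1) s p * (Matrix.of (periodiseF s (toF A)) * Matrix.of (periodiseF s (toF (arr s V))) * Matrix.of (periodiseF s (toF Bk)))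
        * (QindU (m + 1) s p)ᵀ
      = Matrix.of (periodiseF p (toF (arr p (blockSumK m (comp (comp A V) Bk))))) := by
  obtain ⟨C', hW⟩ := biLoc_sandwich hA hδA hB hδB hV hδ
  have hδ' : 0 < min (min δA δB) δ / 4 := by have := lt_min (lt_min hδA hδB) hδ; positivity
  rw [sandwich_arr hA hδA hAper hB hδB hBper hV hδ,
    QindU_mul_periodiseF_mul_QindU_transpose hs _ (fun x y t => arr_imageShift s _ x y t () ()) (fun x => (rowBound_arr hW hδ' s () ()).summable x),
    blockSumK_arr hs hW hδ']

end Dressed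

/-! ## §4 The instance of the road: both legs `Ĝ′Ĝ′` -/

section Ghost

variable (m : ℕ) (a : ℝ) {s p : ℕ} [NeZero s] [NeZero p]

/-- [our object] **`GG := Ggh ∘ Ggh`** — the `ℤ⁴` kernel of the squared tower leg (`(ÂX·ÂX)⁻¹ = Ĝ′·Ĝ′` on every torus, `TorusScalarCoarseGram.inv_AXhat_mul_AXhat`). -/
def GG : MKer 4 Unit := comp (Ggh (m + 1) a) (Ggh (m + 1) a)

variable {m a}

omit [NeZero s] [NeZero p] in
/-- [folklore] `GG` decays (rate half the leg's). -/
theorem decays_GG (ha : 0 < a) :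
    Decays (GG m a) ((Fintype.card Unit : ℝ) * (2 / min 2 a * (2 / min 2 a)) * ExpKernelCalculus.Zl 4 (deltaU 4 a / (4 * ((m + 1 : ℕ) : ℝ)) - deltaU 4 a / (4 * ((m + 1 : ℕ) : ℝ)) / 2))
      (deltaU 4 a / (4 * ((m + 1 : ℕ) : ℝ)) / 2) := by
  have hδ : 0 < deltaU 4 a / (4 * ((m + 1 : ℕ) : ℝ)) := by have := deltaU_pos 4 ha; positivity
  exact decays_comp (decays_Ggh (m + 1) a ha) (decays_Ggh (m + 1) a ha) (half_pos hδ).le (half_lt_self hδ)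

omit [NeZero s] [NeZero p] in
/-- [folklore] The rate of `decays_GG` is positive. -/
theorem rate_GG_pos (ha : 0 < a) : 0 < deltaU 4 a / (4 * ((m + 1 : ℕ) : ℝ)) / 2 := by
  have := deltaU_pos 4 ha; positivity

omit [NeZero s] [NeZero p] in
/-- [folklore] `GG` is jointly `s`-periodic for `(m+1) ∣ s` (`GhostLeg.shiftK_Ggh` + `comp_shiftK`). -/
theorem GG_imageShift (ha : 0 < a) (hs : s = (m + 1) * p) (x y t : X 4) (u v : Unit) :
    GG m a (imageShift s x t) (imageShift s y t) u v = GG m a x y u v := by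
  have e : ∀ z : X 4, imageShift s z t = z + (((m + 1 : ℕ) : ℤ) • ((p : ℤ) • t)) := fun z => by
    funext i; simp only [imageShift_apply, hs, Nat.cast_mul, Pi.add_apply, Pi.smul_apply, smul_eq_mul]; push_cast; ring
  rw [e, e, show GG m a (x + ((m + 1 : ℕ) : ℤ) • ((p : ℤ) • t)) (y + ((m + 1 : ℕ) : ℤ) • ((p : ℤ) • t)) u v
      = shiftK (((m + 1 : ℕ) : ℤ) • ((p : ℤ) • t)) (GG m a) x y u v from rfl, GG, ← comp_shiftK, shiftK_Ggh (m + 1) a ha]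

omit [NeZero p] in
/-- [folklore] **`Ĝ′·Ĝ′ = (GG)^`** in the `× Unit` currency (fibred product rule). -/
theorem periodiseF_Ggh_mul_Ggh (ha : 0 < a) (hs : s = (m + 1) * p) :
    Matrix.of (periodiseF s (toF (Ggh (m + 1) a))) * Matrix.of (periodiseF s (toF (Ggh (m + 1) a))) = Matrix.of (periodiseF s (toF (GG m a))) := by
  have hdiv : m + 1 ∣ s := ⟨p, hs⟩
  have hδ : 0 < deltaU 4 a / (4 * ((m + 1 : ℕ) : ℝ)) := by have := deltaU_pos 4 ha; positivity
  rw [GG, ← toF_comp (fun x z u v f => summable_mul_of_decays_bdd (decays_Ggh (m + 1) a ha) hδ (bdd_Ggh (m + 1) a ha) x z u v f),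
    periodiseF_compF_matrix (summable_abs_row_toF (decays_Ggh (m + 1) a ha) hδ) (isPeriodic₂_Ggh (m + 1) a ha hdiv) (rowBound_Ggh (m + 1) a ha)]

/-- [folklore] **THE S-VERTEX OF THE GHOST SIDE IS A PERIODISED COARSE ARRAY**: for a bi-localised fine vertex `V` and `s = (m+1)·p`
(FILE 3's `Xₛ′ = LₛÂX + ÂXLₛ` is such an array, `(arr (Vₛ∘AX + AX∘Vₛ))^`, when `Lₛ = (arr Vₛ)^`; alternatively use §3 with the legs `(GG, Ggh)` ∕
`(Ggh, GG)` after `ÂX·Ĝ′ = 1`),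
`QindU · Ĝ′Ĝ′·(arr s V)^·Ĝ′Ĝ′ · QindUᵀ = (arr p (blockSumK m ((GG∘V)∘GG)))^`, and the coarse vertex `blockSumK m ((GG∘V)∘GG)` is bi-localised at
`(blk P, blk Q)` — so `TorusGhostGram.tendsto_hessT_CsqK` applies to the coarse `hessT` of `TorusGhostSideZero.hessT_ghost_side_zero` once the fine
jets are arrays. -/
theorem QindU_ghost_sandwich_arr (ha : 0 < a) (hs : s = (m + 1) * p) {V : MKer 4 Unit} {P Q : X 4} {C δ : ℝ} (hV : BiLoc V P Q C δ) (hδ : 0 < δ) :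
    QindU (m + 1) s p * (Matrix.of (periodiseF s (toF (Ggh (m + 1) a))) * Matrix.of (periodiseF s (toF (Ggh (m + 1) a)))
        * Matrix.of (periodiseF s (toF (arr s V)))
        * (Matrix.of (periodiseF s (toF (Ggh (m + 1) a))) * Matrix.of (periodiseF s (toF (Ggh (m + 1) a))))) * (QindU (m + 1) s p)ᵀ
      = Matrix.of (periodiseF p (toF (arr p (blockSumK m (comp (comp (GG m a) V) (GG m a)))))) ∧
    ∃ C' : ℝ, BiLoc (blockSumK m (comp (comp (GG m a) V) (GG m a))) (blk m P) (blk m Q) C'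
      (min (min (deltaU 4 a / (4 * ((m + 1 : ℕ) : ℝ)) / 2) (deltaU 4 a / (4 * ((m + 1 : ℕ) : ℝ)) / 2)) δ / 4) := by
  refine ⟨?_, ?_⟩
  · rw [periodiseF_Ggh_mul_Ggh ha hs]
    exact QindU_sandwich_arr hs (decays_GG ha) (rate_GG_pos ha) (GG_imageShift ha hs) (decays_GG ha) (rate_GG_pos ha) (GG_imageShift ha hs) hV hδ
  · obtain ⟨C', hW⟩ := biLoc_sandwich (decays_GG (m := m) ha) (rate_GG_pos ha) (decays_GG ha) (rate_GG_pos ha) hV hδ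
    exact ⟨_, biLoc_blockSumK m hW (by have := lt_min (lt_min (rate_GG_pos (m := m) ha) (rate_GG_pos (m := m) ha)) hδ; positivity)⟩

end Ghost

/-! ## §5 Normalisation: the compressed one-loop functional is blind to a uniform rescaling of the jets -/

section Scale

open Summit.QuantumFields.BalabanUV.Beta.D1BFx.MixedVarPackedHess (hessT)

variable {ι ρ : Type*} [Fintype ι] [Fintype ρ] [DecidableEq ι] [DecidableEq ρ]

omit [DecidableEq ι] in
/-- [folklore] **`hessT` IS SCALE-FREE**: `hessT (c•X₀)⁻¹ (c•Xₛ) (c•Xₜ) (c•Xₛₜ) = hessT X₀⁻¹ Xₛ Xₜ Xₛₜ` (`c ≠ 0`, `det X₀ ≠ 0`). -/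
theorem hessT_inv_smul {c : ℝ} (hc : c ≠ 0) (X₀ Xₛ Xₜ Xₛₜ : Matrix ρ ρ ℝ) (hX : X₀.det ≠ 0) :
    hessT (c • X₀)⁻¹ (c • Xₛ) (c • Xₜ) (c • Xₛₜ) = hessT X₀⁻¹ Xₛ Xₜ Xₛₜ := by
  have hinv : (c • X₀)⁻¹ = c⁻¹ • X₀⁻¹ :=
    Matrix.inv_eq_right_inv (by rw [Matrix.smul_mul, Matrix.mul_smul, smul_smul, mul_inv_cancel₀ hc, one_smul,
      Matrix.mul_nonsing_inv _ (isUnit_iff_ne_zero.2 hX)])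
  unfold hessT
  rw [hinv]
  simp only [Matrix.smul_mul, Matrix.mul_smul, smul_smul, Matrix.trace_smul, smul_eq_mul]
  field_simp

omit [DecidableEq ι] in
/-- [folklore] **THE COMPRESSED FUNCTIONAL IS NORMALISATION-FREE**: rescaling all four jets `X ↦ c•X` inside the Gram sandwich `NᵀXN` does not change
`hessT (NᵀX₀N)⁻¹ (NᵀXₛN) (NᵀXₜN) (NᵀXₛₜN)` — so `TorusGhostSideZero.hessT_ghost_side_zero(_Nhat)`, stated for the jets of `((m+1)²•L̂)²`, applies verbatim
to the jets of `L̂²` ∕ of `G(U) = N̂ᵀL_UL_UN̂` in any normalisation of the Laplacian (`c = (m+1)⁴`), the `det ≠ 0` being FILE 2's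
`det_compressed_lap_sq_ne_zero`. -/
theorem hessT_sandwich_smul {c : ℝ} (hc : c ≠ 0) (N : Matrix ι ρ ℝ) (X₀ Xₛ Xₜ Xₛₜ : Matrix ι ι ℝ) (hX : (Nᵀ * X₀ * N).det ≠ 0) :
    hessT (Nᵀ * (c • X₀) * N)⁻¹ (Nᵀ * (c • Xₛ) * N) (Nᵀ * (c • Xₜ) * N) (Nᵀ * (c • Xₛₜ) * N)
      = hessT (Nᵀ * X₀ * N)⁻¹ (Nᵀ * Xₛ * N) (Nᵀ * Xₜ * N) (Nᵀ * Xₛₜ * N) := by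
  simp only [Matrix.mul_smul, Matrix.smul_mul]
  exact hessT_inv_smul hc _ _ _ _ hX

end Scale

end Summit.QuantumFields.BalabanUV.Beta.D1BFx.TorusScalarCoarseArrays

end
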